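/-
Copyright (c) 2026. All rights reserved.
Released under Apache 2.0 license as described in the file LICENSE.
Authors: abc-iut cell, seat abc-iut-w6-d025 (gen 2; block C / W6, row «Cor36-LOGOBS-TELE»).
-/
import Literature.AnabelianGeometry.AbsoluteAnabelian.DiagramLifts
import Mathlib.CategoryTheory.Whiskering

/-!
# Homotopies lying over the structure functors ([AbsTopIII] Def. 3.5 (ii)–(iv), toolkit IV)

S. Mochizuki, *Topics in Absolute Anabelian Geometry III*, Def. 3.5 (ii)–(iv) pp. 75–76 and
Rmk. 3.5.1 p. 78 (manuscript `paper:url-5493eb38cbb7`, bib key `MochizukiAbsTopIII2015`); proof of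
Cor. 3.6 (i)/(iii), p. 81: "immediate from the definitions — i.e., in essence, because the various
Galois groups that appear remain 'undisturbed'".  Continuation of seat abc-iut-L4-t5's
`DiagramLifts.lean` (`OverData`: structure functors `N_v : 𝒟_v ⥤ 𝒞` with `μ_e : 𝒟_e ⋙ N ≅ N`, the
isomorphisms `pathIso γ : 𝒟_[γ] ⋙ N ≅ N`, and the lifts through fully faithful `N_w`).

A homotopy `θ : 𝒟_[γ₁] ⟶ 𝒟_[γ₂]` **lies over** the structure functors (`OverData.IsOver`) if
`θ ▷ N_b` is the canonical identification `pathIso γ₁ ∘ pathIso γ₂⁻¹` — the precise form of "the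
Galois groups remain undisturbed".  This file proves: identities and composites of over-homotopies are
over (`isOver_id`, `IsOver.comp`); over-ness is stable under pre- and post-whiskering with path
functors (`IsOver.whiskerLeft`, `IsOver.whiskerRight`, `IsOver.whisker`; Def. 3.5 (ii) whiskering
axiom); the lifts are over (`isOver_lift`); and **uniqueness**: into a vertex whose structure functor
is faithful there is at most one over-homotopy (`IsOver.eq_of_faithful`), which is the lift when the
functor is fully faithful (`IsOver.eq_lift`).  Consumer: the telecore half of Cor. 3.6 (iii) (seat
abc-iut-w6-d025, row «Cor36-LOGOBS-TELE»), where every homotopy of the glued family on `𝒟_An` lies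
over `ℰ` and the family axioms at the faithful vertices follow from uniqueness.  Pure category theory
(`eqToHom` bookkeeping); no claim of the paper is asserted.
-/

namespace Literature.AnabelianGeometry.AbsoluteAnabelian

open _root_.CategoryTheory _root_.Quiver

universe v u w

namespace DiagramOfCategories

namespace OverData

variable {V : Type w} [Quiver.{v} V] {D : DiagramOfCategories.{v, u, w} V} {C : Type u}
  [Category.{v} C] (O : D.OverData C)

/-- **A homotopy lying over the structure functors**: `θ : 𝒟_[γ₁] ⟶ 𝒟_[γ₂]` (co-verticial
`[γ₁], [γ₂] : a ⟶ b`) such that `θ ▷ N_b` is the canonical identification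
`pathIso γ₁ ∘ pathIso γ₂⁻¹ : 𝒟_[γ₁] ⋙ N_b ≅ N_a ≅ 𝒟_[γ₂] ⋙ N_b` ("the Galois groups remain undisturbed",
proof of Cor. 3.6 (i)/(iii)). [cite: MochizukiAbsTopIII2015, Corollary 3.6 (iii) p.81] -/
def IsOver {a b : V} (P Q : Path a b) (θ : D.pathFunctor P ⟶ D.pathFunctor Q) : Prop :=
  Functor.whiskerRight θ (O.N b) = (O.pathIso P).hom ≫ (O.pathIso Q).inv

variable {O}

/-- Over-ness componentwise: `N_b(θ_x) = (pathIso γ₁)_x ∘ (pathIso γ₂)⁻¹_x`.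
[cite: MochizukiAbsTopIII2015, Corollary 3.6 (iii) p.81] -/
theorem IsOver.map_app {a b : V} {P Q : Path a b} {θ : D.pathFunctor P ⟶ D.pathFunctor Q}
    (h : O.IsOver P Q θ) (x : D.obj a) :
    (O.N b).map (θ.app x) = (O.pathIso P).hom.app x ≫ (O.pathIso Q).inv.app x :=
  NatTrans.congr_app h x

/-- Over-ness from the componentwise identities. [cite: MochizukiAbsTopIII2015, Corollary 3.6 (iii) p.81] -/
theorem isOver_of_map_app {a b : V} {P Q : Path a b} {θ : D.pathFunctor P ⟶ D.pathFunctor Q}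
    (h : ∀ x : D.obj a, (O.N b).map (θ.app x) = (O.pathIso P).hom.app x ≫ (O.pathIso Q).inv.app x) :
    O.IsOver P Q θ :=
  NatTrans.ext (funext h)

/-- The identity homotopy lies over the structure functors. [cite: MochizukiAbsTopIII2015, Definition 3.5 (ii) p.75] -/
theorem isOver_id {a b : V} (P : Path a b) : O.IsOver P P (𝟙 _) := by
  rw [IsOver, Functor.whiskerRight_id', Iso.hom_inv_id]

/-- Composites of over-homotopies are over (Def. 3.5 (ii): `ζ_{ϖ''} = ζ_{ϖ'} ∘ ζ_ϖ`).
[cite: MochizukiAbsTopIII2015, Definition 3.5 (ii) p.75] -/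
theorem IsOver.comp {a b : V} {P Q R : Path a b} {θ : D.pathFunctor P ⟶ D.pathFunctor Q}
    {θ' : D.pathFunctor Q ⟶ D.pathFunctor R} (h : O.IsOver P Q θ) (h' : O.IsOver Q R θ') :
    O.IsOver P R (θ ≫ θ') := by
  unfold IsOver at h h' ⊢
  rw [Functor.whiskerRight_comp, h, h', Category.assoc, Iso.inv_hom_id_assoc]

/-- Over-ness is invariant under re-indexing the pair along equalities of paths (bookkeeping).
[cite: MochizukiAbsTopIII2015, Definition 3.5 (ii) p.75] -/
theorem IsOver.congr {a b : V} {P P' Q Q' : Path a b} (hP : P = P') (hQ : Q = Q')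
    {θ : D.pathFunctor P ⟶ D.pathFunctor Q} (h : O.IsOver P Q θ) :
    O.IsOver P' Q' (eqToHom (by rw [hP]) ≫ θ ≫ eqToHom (by rw [hQ])) := by
  subst hP hQ
  simpa using h

/-- **The lifts through a fully faithful structure functor are over** (their defining property,
`OverData.map_lift_app`). [cite: MochizukiAbsTopIII2015, Remark 3.5.1 p.78] -/
theorem isOver_lift {a w : V} (hw : (O.N w).FullyFaithful) (p q : Path a w) :
    O.IsOver p q (O.lift hw p q) :=
  isOver_of_map_app fun x => O.map_lift_app hw p q x

/-- **Uniqueness at a faithful vertex**: two over-homotopies of the same pair into a vertex whose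
structure functor is faithful are equal. [cite: MochizukiAbsTopIII2015, Remark 3.5.1 p.78] -/
theorem IsOver.eq_of_faithful {a b : V} {P Q : Path a b} [(O.N b).Faithful]
    {θ θ' : D.pathFunctor P ⟶ D.pathFunctor Q} (h : O.IsOver P Q θ) (h' : O.IsOver P Q θ') :
    θ = θ' :=
  ((Functor.whiskeringRight (D.obj a) (D.obj b) C).obj (O.N b)).map_injective (h.trans h'.symm)

/-- At a fully faithful vertex the unique over-homotopy is the lift. [cite: MochizukiAbsTopIII2015, Remark 3.5.1 p.78] -/
theorem IsOver.eq_lift {a w : V} (hw : (O.N w).FullyFaithful) {p q : Path a w}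
    {θ : D.pathFunctor p ⟶ D.pathFunctor q} (h : O.IsOver p q θ) : θ = O.lift hw p q :=
  O.lift_ext hw θ h.map_app

/-! ### Stability under whiskering with path functors (Def. 3.5 (ii), whiskering axiom) -/

/-- Right whiskering commutes with `eqToHom` (bookkeeping). [folklore] -/
private theorem whiskerRight_eqToHom' {A B : Type u} [Category.{v} A] [Category.{v} B]
    {F G : A ⥤ B} (e : F = G) (N : B ⥤ C) :
    Functor.whiskerRight (eqToHom e) N = eqToHom (by rw [e]) := by
  subst e
  rw [eqToHom_refl, eqToHom_refl, Functor.whiskerRight_id']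

/-- Left whiskering commutes with `eqToHom` (bookkeeping). [folklore] -/
private theorem whiskerLeft_eqToHom' {A B : Type u} [Category.{v} A] [Category.{v} B]
    (R : A ⥤ B) {F G : B ⥤ C} (e : F = G) :
    Functor.whiskerLeft R (eqToHom e) = eqToHom (by rw [e]) := by
  subst e
  rw [eqToHom_refl, eqToHom_refl, Functor.whiskerLeft_id']

/-- **Pre-whiskering preserves over-ness**: if `θ` is over `([γ₁],[γ₂])` then
`𝒟_[ρ] ◁ θ` (re-typed along `𝒟_[γ∘ρ] = 𝒟_[γ] ∘ 𝒟_[ρ]`) is over `([γ₁]∘[ρ], [γ₂]∘[ρ])`.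
[cite: MochizukiAbsTopIII2015, Definition 3.5 (ii) p.75] -/
theorem IsOver.whiskerLeft {c a b : V} {P Q : Path a b} {θ : D.pathFunctor P ⟶ D.pathFunctor Q}
    (h : O.IsOver P Q θ) (r : Path c a) :
    O.IsOver (r.comp P) (r.comp Q)
      (eqToHom (D.pathFunctor_comp r P) ≫ Functor.whiskerLeft (D.pathFunctor r) θ ≫
        eqToHom (D.pathFunctor_comp r Q).symm) := by
  unfold IsOver at h ⊢
  rw [Functor.whiskerRight_comp, Functor.whiskerRight_comp, whiskerRight_eqToHom',
    whiskerRight_eqToHom', O.pathIso_comp_eq r P, O.pathIso_comp_eq r Q]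
  -- `(𝒟_[ρ] ◁ θ) ▷ N = 𝒟_[ρ] ◁ (θ ▷ N)` definitionally
  change eqToHom _ ≫ Functor.whiskerLeft (D.pathFunctor r) (Functor.whiskerRight θ (O.N b)) ≫ eqToHom _ = _
  rw [h, Functor.whiskerLeft_comp]
  simp only [Iso.trans_hom, Iso.trans_inv, eqToIso.hom, eqToIso.inv, Functor.isoWhiskerLeft_hom,
    Functor.isoWhiskerLeft_inv, Category.assoc, Iso.hom_inv_id_assoc]

/-- **Post-whiskering preserves over-ness**: if `θ` is over `([γ₁],[γ₂])` then `θ ▷ 𝒟_[σ]` (re-typed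
along `𝒟_[σ∘γ] = 𝒟_[σ] ∘ 𝒟_[γ]`) is over `([σ]∘[γ₁], [σ]∘[γ₂])`.
[cite: MochizukiAbsTopIII2015, Definition 3.5 (ii) p.75] -/
theorem IsOver.whiskerRight {a b d : V} {P Q : Path a b} {θ : D.pathFunctor P ⟶ D.pathFunctor Q}
    (h : O.IsOver P Q θ) (s : Path b d) :
    O.IsOver (P.comp s) (Q.comp s)
      (eqToHom (D.pathFunctor_comp P s) ≫ Functor.whiskerRight θ (D.pathFunctor s) ≫
        eqToHom (D.pathFunctor_comp Q s).symm) := by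
  unfold IsOver at h ⊢
  rw [Functor.whiskerRight_comp, Functor.whiskerRight_comp, whiskerRight_eqToHom',
    whiskerRight_eqToHom', O.pathIso_comp_eq P s, O.pathIso_comp_eq Q s]
  -- `(θ ▷ 𝒟_[σ]) ▷ N_d = θ ▷ (𝒟_[σ] ⋙ N_d)`, and `pathIso σ : 𝒟_[σ] ⋙ N_d ≅ N_b` is natural in `θ`
  change eqToHom _ ≫ Functor.whiskerRight θ (D.pathFunctor s ⋙ O.N d) ≫ eqToHom _ = _
  have hn : Functor.whiskerRight θ (D.pathFunctor s ⋙ O.N d) =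
      Functor.whiskerLeft (D.pathFunctor P) (O.pathIso s).hom ≫ Functor.whiskerRight θ (O.N b) ≫
        Functor.whiskerLeft (D.pathFunctor Q) (O.pathIso s).inv := by
    ext x
    simp only [Functor.whiskerRight_app, NatTrans.comp_app, Functor.whiskerLeft_app, Functor.comp_map]
    have := (O.pathIso s).hom.naturality (θ.app x)
    simp only [Functor.comp_map] at this
    rw [← Category.assoc]
    exact (Iso.eq_comp_inv ((O.pathIso s).app ((D.pathFunctor Q).obj x))).mpr this
  rw [hn, h]
  simp only [Iso.trans_hom, Iso.trans_inv, eqToIso.hom, eqToIso.inv, Functor.isoWhiskerLeft_hom,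
    Functor.isoWhiskerLeft_inv, Category.assoc]

/-- Pre- and post-whiskering at once, in the shape of the whiskering axiom `η_whisker` of a family of
homotopies (Def. 3.5 (ii)): if `θ` is over `([γ₁],[γ₂])` then `𝒟_[ρ₁] ◁ θ ▷ 𝒟_[ρ₂]`, re-typed, is over
`([ρ₂]∘[γ₁]∘[ρ₁], [ρ₂]∘[γ₂]∘[ρ₁])`. [cite: MochizukiAbsTopIII2015, Definition 3.5 (ii) p.75] -/
theorem IsOver.whisker {c a b d : V} {P Q : Path a b} {θ : D.pathFunctor P ⟶ D.pathFunctor Q}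
    (h : O.IsOver P Q θ) (r₁ : Path c a) (r₂ : Path b d) :
    O.IsOver (r₁.comp (P.comp r₂)) (r₁.comp (Q.comp r₂))
      (eqToHom (by rw [pathFunctor_comp, pathFunctor_comp]) ≫
        Functor.whiskerLeft (D.pathFunctor r₁) (Functor.whiskerRight θ (D.pathFunctor r₂)) ≫
        eqToHom (by rw [pathFunctor_comp, pathFunctor_comp])) := by
  have h₁ := (h.whiskerRight r₂).whiskerLeft r₁
  refine Eq.trans ?_ h₁
  congr 1
  rw [Functor.whiskerLeft_comp, Functor.whiskerLeft_comp, whiskerLeft_eqToHom', whiskerLeft_eqToHom']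
  simp only [Category.assoc, eqToHom_trans, eqToHom_trans_assoc]

end OverData

end DiagramOfCategories

end Literature.AnabelianGeometry.AbsoluteAnabelian
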